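import Literature.NumberTheory.EllipticCurves.Castella2018.ErratumHidaMembersFrames
import HarnessLib

/-!
# Castella's erratum, proof of Thm. 1.1 (p. 4): the PUBLISHED member data with frames — F3♯-nonsplit WITH THE WEIGHT PROGRESSION
# `k_m ≡ 2 (mod 2(p−1)p^{m−1})` (the members on which the self-dual lattices `T^†_{g_m}` are congruent to `T_pE` modulo `p^m`)

Cell `bsd-stepL`, seat `bsd-stepL-imc-p1` g24 — TWIST AUDIT of crux `ErratumThm23SigmaLe` (item stmt-BirchSwinnertonDyer-25505), repair
step (R3) (memo `run/shared/lean/pub/bsd-stepL/imc-p1/g24/TWIST-AUDIT-25505-imc-p1-g24.md`). ONE new named `Prop` (D-0014: +1 unproved; a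
CONJUNCTION of published results, each cited), BYTE-IDENTICAL with `erratum_exists_frames_members_sigma_congruence_nonsplit` (file
`ErratumHidaMembersFrames.lean`; all its binders, transcription and flags `MF-*` apply verbatim) EXCEPT for ONE added conjunct inside the
member existential: `2(p−1)p^{m−1} ∣ k_m − 2`.

## Why the extra conjunct, and why it is print

The erratum's `A_{g_m}` is the SELF-DUAL Tate twist (§2, p. 2: «Let `V_g` be the self-dual Tate twist … `T_g ⊂ V_g` … [Nek92, § 3] …
`A_g := V_g/T_g`»), and its (b) «an isomorphism `T_{g_m}/p^m T_{g_m} ≃ T/p^m T` as `𝒪[G_ℚ]`-modules» is for THAT lattice. The tree's member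
`D : Skinner2016.HidaCongruentMember W p m` carries (b) for the UNTWISTED lattice `D.Δ.ρ` (Hida theory's congruence of `q`-expansions,
[Ski16 §2.6 (2-6-1)]); the two lattices differ by `ε^{1−k_m/2}`, which is `≡ 1 (mod p^m)` on `G_ℚ` exactly when `(p−1)p^{m−1} ∣ k_m/2 − 1`
(Euler), i.e. `2(p−1)p^{m−1} ∣ k_m − 2` — then (b) for `D.Δ.ρ` IS (b) for the self-dual `D.Δ.selfDualRep` (tree:
`Summit.….Theorems.SelfDualTwist.exists_equivariant_equiv_selfDual`). Print's (a) «`k_m > 2` with `k_m ≡ 2 (mod p − 1)`» names the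
coarse residue class; Hida theory supplies arithmetic specialisations at EVERY weight `k > 2`, `k ≡ 2 (mod p−1)` [Ski16 §2.6: "for each `m`
there is `φ_{k'}` … `k' ≡ 2 (mod p−1)` … `a_ℓ(f_{φ_{k'}}) ≡ a_ℓ(f) (mod p^m)`", obtained for `k'` `p`-adically close to `2`], so the members
may be — and, for the erratum's self-dual (b) to hold, must be — taken in the sub-progression `k_m ≡ 2 (mod 2(p−1)p^{m−1})`. (The sibling
re-type's own docstring already records that only members with `k = 2 + (p−1)p^{m−1}t`, `t` EVEN, carry the printed Steinberg sign.) The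
added conjunct makes the `Prop` STRONGER than F3♯-nonsplit by exactly this published choice; nothing else changes.
STATUS: PUBLISHED inputs only ([Cas18 Thm. 3.1], [Ski16 §2.6], [Cas20 Thm. 2.11], [FO12 L.2.14], [Ski20 L.2.8.1]); no `p`-adic
`L`-function is constructed here.

## References

* [Castella2018Erratum] §2 (p. 2), proof of Thm. 1.1 (a)(b)(c), footnote 1 (p. 4). [Skinner2016PacificMC] §2.6 (2-6-1), §3.1 (a)(b).
* [Castella2020JIMJ] Thm. 2.11. [Castella2018] Thm. 3.1, (3.1). [FouquetOchiai2012] Lem. 2.14. [Skinner2020] Lem. 2.8.1.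
-/

noncomputable section

open scoped Classical

open PowerSeries WeierstrassCurve NumberField IsDedekindDomain Field
  Literature.NumberTheory.EllipticCurves Literature.NumberTheory.EllipticCurves.ModularForms
  Literature.NumberTheory.EllipticCurves.Rank1Residual Literature.NumberTheory.EllipticCurves.BigGaloisRep
  Literature.NumberTheory.EllipticCurves.GreenbergSelmer Literature.NumberTheory.GaloisRepresentations

namespace Literature.NumberTheory.EllipticCurves.Castella2018

/-- **Castella's erratum, proof of Thm. 1.1 — the PUBLISHED member data with frames, print-faithful re-type (F3♯-nonsplit) WITH the
member weights in the progression `k_m ≡ 2 (mod 2(p−1)p^{m−1})`** (one added conjunct inside the member existential; everything else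
BYTE-IDENTICAL with `erratum_exists_frames_members_sigma_congruence_nonsplit`, whose binders, transcription and flags `MF-*` apply; see the
module docstring for why the progression is the one on which the erratum's own (b) — for the SELF-DUAL lattice — holds). A conjunction of
published results (D-0014); nothing about `p`-adic `L`-functions is constructed here.
[cite: Castella2018Erratum, §2 (p. 2), Thm. 1.1 hypothesis (iii) and footnote 1, proof of Thm. 1.1 (a)(b)(c) (p. 4)]
[cite: Skinner2016PacificMC, §2.6 (2-6-1) and §3.1 (a)(b) (p. 192) (members at weights `k' ≡ 2 (mod p−1)` `p`-adically close to `2`)]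
[cite: Castella2020JIMJ, Def. 2.10, Thm. 2.11 and Rem. 2.12] [cite: Castella2018, Thm. 3.1, (3.1) (p. 9), (4.1)]
[cite: Skinner2020, Lem. 2.8.1] [cite: FouquetOchiai2012, Lem. 2.14] [cite: JetchevSkinnerWan2017, §5.1] -/
def erratum_exists_frames_members_sigma_congruence_nonsplit_wt : Prop :=
  ∀ {p : ℕ} [Fact p.Prime] (ι : PadicAlgCl p ≃+* ℂ) (W : WeierstrassCurve ℚ) [W.IsElliptic]
    [W.IsGloballyMinimal] (K : Type) [Field K] [NumberField K]
    (𝔭 : HeightOneSpectrum (𝓞 K)) (κ : ZpExtension K p) (γ : absoluteGaloisGroup K)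
    [Fact (κ.IsTopGenerator γ)] {N : ℕ} [NeZero N] {f : CuspForm (CongruenceSubgroup.Gamma0 N) 2}
    (_ : IsNewformOf W f) (q : ℕ) [Fact q.Prime],
    -- "`E/ℚ` … of conductor `N` with multiplicative reduction at `p > 3`", `M = N/p ≥ 3`, (i) `E[p]` irreducible
    W.conductorNorm ℤ = N → 3 < p → Mult W p → 3 ≤ N / p → Irr W p →
    -- PRINT HYPOTHESIS (iii), first half, of the erratum's Thm. 1.1 (= arXiv:2409.01360 Thm. 1.3 / Thm. 3.1): "`E` has nonsplit
    -- multiplicative reduction at each prime `q ∥ N` which is nonsplit in `K`" — the tree's erratum spelling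
    -- (`erratumThm11_exists_isBDPLFunction_isTorsion_charIdeal_eq_OPEN`); by footnote 1 it is the printed source of the
    -- Steinberg-sign conjunct of the conclusion [FO12 L.2.14]; ABSENT from the vet-returned original above
    (∀ (ℓ : ℕ) [Fact ℓ.Prime], Mult W ℓ → ((Ideal.span {(ℓ : ℤ)}).primesOver (𝓞 K)).ncard ≠ 2 →
      ¬ W.HasSplitMultiplicativeReductionAtPrime ℓ) →
    -- the (iii)-witness `q`: multiplicative, non-split in `K`, `E[p]` ramified at `q`
    Mult W q → ((Ideal.span {(q : ℤ)}).primesOver (𝓞 K)).ncard ≠ 2 → ¬ p ∣ padicValInt q W.minimalDiscriminantInt →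
    -- `K` imaginary quadratic, `d_K` odd [Cas20 §2.5], Heegner for `N`, `p = 𝔭𝔭̄` split, `𝔭` via `ι`
    IsImaginaryQuadratic K → Odd (NumberField.discr K) → (∃ β : ℤ, (4 * N : ℤ) ∣ β ^ 2 - NumberField.discr K) →
    ((Ideal.span {(p : ℤ)}).primesOver (𝓞 K)).ncard = 2 →
    ((p : ℕ) : 𝓞 K) ∈ 𝔭.asIdeal →
    (∀ (w : InfinitePlace K) (x : 𝓞 K), x ∈ 𝔭.asIdeal ↔ ‖ι.symm (w.embedding (x : K))‖ < 1) →
    -- `Γ` THE anticyclotomic `ℤ_p`-extension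
    κ.IsAnticyclotomic →
    -- receptacle maps: `a : R₀ ⊆ 𝓞_{ℂ_p}` the inclusion, `j : ℤ_p → R₀` the structure map (characterised)
    ∀ (a : unrIntegers p →+* PadicComplexInt p) (j : ℤ_[p] →+* unrIntegers p),
      (∀ x : unrIntegers p, ((a x : PadicComplexInt p) : ℂ_[p]) = (x : ℂ_[p])) →
      (∀ x : ℤ_[p], ((j x : unrIntegers p) : ℂ_[p]) = algebraMap ℚ_[p] ℂ_[p] (x : ℚ_[p])) →
    -- THEN: an `R₀`-frame of `f` at `(ι, 𝔭)` [Cas18 Thm. 3.1] …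
    ∃ (ΩK : ℂ) (Ωp : (unrIntegers p)ˣ) (L : UnrSeries p),
      ΩK ≠ 0 ∧ IsBDPLFunction ι 𝔭 κ γ f ΩK ((Ωp : unrIntegers p) : ℂ_[p]) L ∧
      -- … and for every `m ≥ 1` a member (a)+(b) with its printed properties and its Σ-imprimitive `p`-adic `L`-function
      ∀ m : ℕ, 1 ≤ m →
        ∃ (D : Skinner2016.HidaCongruentMember W p m) (Qm : PowerSeries (PadicComplexInt p)),
          -- the member's weight lies in the progression `k_m ≡ 2 (mod 2(p−1)p^{m−1})` (Hida theory: arithmetic specialisations of every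
          -- weight `k ≡ 2 (mod p−1)`, `k > 2`; the sub-progression on which the SELF-DUAL lattices are congruent, `ε^{1−k_m/2} ≡ 1 (mod p^m)`)
          (2 * ((p : ℤ) - 1) * (p : ℤ) ^ (m - 1)) ∣ D.k - 2 ∧
          -- the member's `p`-adic coefficient embedding IS the fixed `ı_p = ι⁻¹` on `ℚ(g_m) ⊂ ℂ` ("defined over `𝒪`"; flag `MF-compat`)
          (∀ x : coeffField D.g, ι (D.ι x) = (x : ℂ)) ∧
          -- footnote 1: `ρ̄_{g_m} ≃ E[p]` is irreducible and ramified at `q`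
          SkinnerUrban2014.IsResiduallyIrreducible D.Δ ∧
          (∃ v : HeightOneSpectrum (𝓞 ℚ), ((Rat.HeightOneSpectrum.primesEquiv v : Nat.Primes) : ℕ) = q ∧
            SkinnerUrban2014.IsResiduallyRamifiedAt D.Δ v) ∧
          -- rigidity of automorphic types [FO12 L.2.14]: `π(g_m)_ℓ` special ⊗ (`ℓ ↦ −ℓ^{k_m/2−1}`) at every `ℓ ∣ M` non-split in `K`
          (∀ ℓ : ℕ, ℓ.Prime → ℓ ∣ N / p → ((Ideal.span {(ℓ : ℤ)}).primesOver (𝓞 K)).ncard ≠ 2 →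
            (UpperHalfPlane.qExpansion 1 ⇑D.g).coeff ℓ = -((ℓ : ℂ) ^ (D.k / 2 - 1).toNat)) ∧
          -- `Q_m = L^Σ_p(g_m)`: the Σ-imprimitive frame of `g_m` for the SAME periods [Cas20 Thm. 2.11, JSW17 §5.1]
          IsBDPLFunctionWtSigmaInt ι 𝔭 κ γ D.g (W.sigmaPlacesFinset p K) ΩK ((Ωp : unrIntegers p) : ℂ_[p]) Qm ∧
          -- (c): `(L^Σ_p(g_m), p^m) = (L^Σ_p(f), p^m)`, `L^Σ_p(f) = L_p(f)·P_Σ` [Cas18 (3.1)], read in `𝓞_{ℂ_p}⟦T⟧`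
          Ideal.span {Qm} ⊔ Ideal.span {(PowerSeries.C (((p : ℕ) : PadicComplexInt p) ^ m))} =
            Ideal.span {PowerSeries.map a (L * PowerSeries.map j (W.sigmaEulerElement p K κ))} ⊔
              Ideal.span {(PowerSeries.C (((p : ℕ) : PadicComplexInt p) ^ m))}

end Literature.NumberTheory.EllipticCurves.Castella2018

end
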